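import Literature.Computability.Cryptography.BLPRSMachineKernelParams
import Literature.Computability.Cryptography.BLPRSSection4CapParams
import Literature.Computability.Cryptography.BLPRSRateGuess
import Literature.Computability.Cryptography.LWERateGuessPerturb
import Literature.Computability.Cryptography.CoinBlockLaws
import HarnessLib

/-!
# The h₃ machine's rate-guess test at the level of laws: reference blocks from residues, the test, and its closeness to the ideal test

Topic `Computability/Cryptography` (LWE), grouping namespace `BLPRS2013`; sequel of `BLPRSMachineKernelParams.lean` (the machine's rows
`machGridRow` and `eventually_tvDist_machGridRow_le_pow`), `BLPRSRateGuess.lean` (the ideal rows `rateGuessKernel`) and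
`LWERateGuessPerturb.lean` (`abs_acceptProb_flatGuessTest_sub_le`: perturbed kernels and reference law cost `G·(N·δ_κ) + N'·δ_U`).
Here the machine's version of the IDEAL test of `BLPRSSection4Capstone.lean` is written down as a law and shown `1/n^k`-close to it
on every input law, for all large `n` (everything PROVED, definitions with bodies, no named fact):

* `machRefBlock q m₃ n` — the machine's self-generated "uniform" reference block: every residue mod `q` of the `m₃(n)` samples is a
  uniform coin block `< 2ᴸ` reduced mod `q` (`LWE.modLaw`); `tvDist_machRefBlock_le` (`≤ m₃·(n+1)·q/2ᴸ`);
* `idealTest q m₃ c c_D c₃ n K` (`= flatGuessTest K N m₃ (rateGuessKernel …) U N θ` at the parameters of the capstone) and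
  **`machTest q m₃ c c_D c₃ n K`** (the same estimate-and-flag test with the machine's rows `machGridRow` and reference blocks
  `machRefBlock`); `gridRow_eq_rateGuessKernel`;
* `isPolyBounded_gridGN`, **`eventually_machTest_close`** — for polynomially bounded `q, m₃` and every `k`: eventually, for every test
  `K` and every input law `P`, `|Pr[machTest(P)] - Pr[idealTest(P)]| ≤ 1/n^k` — the hypothesis `hA'` of
  `BLPRSSection4AssemblyClose.section4_selected_of_close`.

## References

* Z. Brakerski, A. Langlois, C. Peikert, O. Regev, D. Stehlé, *Classical hardness of learning with errors*, STOC 2013;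
  arXiv:1306.0281, Lemma 2.15, Cor. 3.2 and §5 (finite precision: negligible statistical distance). [BrakerskiEtAl2013]
* O. Regev, *On lattices, learning with errors …*, J. ACM 56 (2009), Lemma 4.1 (proof: uniform shifts from coins). [RegevLWE2009]
* O. Goldreich, *Foundations of Cryptography I*, CUP 2001, §3.2.3 (statistical distance of independent samples). [Goldreich2001]
-/

noncomputable section

open Filter MeasureTheory Literature.Algebra.EuclideanLattices Literature.Probability.Distributions
  Literature.Computability.Complexity
open scoped Real ENNReal

namespace Literature.Computability.Cryptography

namespace BLPRS2013

open LWE LWE.MP12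

/-! ### Reference blocks from residues -/

section Ref

variable (q : ℕ → ℕ) [∀ n, NeZero (q n)] (m₃ : ℕ → ℕ) (n : ℕ)

/-- **One machine "uniform" sample**: `n + 1` residues mod `q` of uniform coin blocks `< 2ᴸ`. [cite: RegevLWE2009, Lemma 4.1 (proof)] -/
def machRefSample : PMF ((Fin n → ZMod (q n)) × ZMod (q n)) :=
  prodLaw (iidPMF (modLaw (resM q n) (q n)) n) (modLaw (resM q n) (q n))

/-- **The machine's reference block**: `m₃(n)` independent machine samples. [cite: BrakerskiEtAl2013, Lemma 2.15 (proof sketch: "estimate 𝒜's success probability on the uniform distribution")] -/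
def machRefBlock : PMF (Fin (m₃ n) → (Fin n → ZMod (q n)) × ZMod (q n)) :=
  iidPMF (machRefSample q n) (m₃ n)

variable {q m₃ n}

/-- **One machine sample is `(n+1)·2^{-n}`-close to uniform** (`q/2ᴸ ≤ 2^{-n}`). [cite: RegevLWE2009, Lemma 4.1 (proof); Goldreich2001, §3.2.3] -/
theorem tvDist_machRefSample_le (q : ℕ → ℕ) [∀ n, NeZero (q n)] (n : ℕ) :
    (machRefSample q n).tvDist (PMF.uniformOfFintype ((Fin n → ZMod (q n)) × ZMod (q n))) ≤ ((n : ℝ) + 1) * (1 / (2 : ℝ) ^ n) := by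
  rw [uniformOfFintype_prod_eq_bind]
  change (prodLaw _ _).tvDist (prodLaw (PMF.uniformOfFintype (Fin n → ZMod (q n))) (PMF.uniformOfFintype (ZMod (q n)))) ≤ _
  refine (tvDist_prodLaw_le _ _ _ _).trans ?_
  have h1 := tvDist_iidPMF_modLaw_le (resM q n) (q n) n
  have h2 := tvDist_modLaw_uniform_le (resM q n) (q n)
  have h3 := cast_q_div_resM_le q n
  have hn : (0 : ℝ) ≤ n := Nat.cast_nonneg n
  calc (iidPMF (modLaw (resM q n) (q n)) n).tvDist (PMF.uniformOfFintype (Fin n → ZMod (q n))) +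
        (modLaw (resM q n) (q n)).tvDist (PMF.uniformOfFintype (ZMod (q n)))
      ≤ n * ((q n : ℝ) / (resM q n : ℝ)) + (q n : ℝ) / (resM q n : ℝ) := add_le_add h1 h2
    _ = ((n : ℝ) + 1) * ((q n : ℝ) / (resM q n : ℝ)) := by ring
    _ ≤ ((n : ℝ) + 1) * (1 / (2 : ℝ) ^ n) := mul_le_mul_of_nonneg_left h3 (by positivity)

/-- **The machine's reference block is `m₃(n+1)·2^{-n}`-close to a uniform block.** [cite: Goldreich2001, §3.2.3] -/
theorem tvDist_machRefBlock_le (q : ℕ → ℕ) [∀ n, NeZero (q n)] (m₃ : ℕ → ℕ) (n : ℕ) :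
    (machRefBlock q m₃ n).tvDist (uniformSamples (Fin n) (ZMod (q n)) (m₃ n)) ≤ (m₃ n : ℝ) * (((n : ℝ) + 1) * (1 / (2 : ℝ) ^ n)) := by
  rw [uniformSamples_eq_iidPMF_holds, machRefBlock]
  exact (tvDist_iidPMF_le _ _ _).trans (mul_le_mul_of_nonneg_left (tvDist_machRefSample_le q n) (Nat.cast_nonneg _))

end Ref

/-! ### The two tests -/

section Tests

variable (q : ℕ → ℕ) [∀ n, NeZero (q n)] (m₃ : ℕ → ℕ) (c cD c₃ : ℕ) (n : ℕ)

/-- **The ideal rate-guess test of the capstone** (`BLPRSSection4Capstone.section4_law_eventually`): rows `rateGuessKernel` with radius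
`gridRadius`, bound `√n`, raisings `gridTau`, uniform reference blocks, `N = N' = gridBatches`, `θ = 1/(4n^{c₃+1})`.
[cite: BrakerskiEtAl2013, Lemma 2.15 with Cor. 3.2 and p. 13] -/
def idealTest (K : (Fin (m₃ n) → (Fin n → ZMod (q n)) × ZMod (q n)) → PMF Bool) :
    Distinguisher (Fin n) (ZMod (modulus n)) (gridG q cD n * (gridBatches q cD c₃ n * m₃ n)) :=
  flatGuessTest K (gridBatches q cD c₃ n) (m₃ n)
    (rateGuessKernel n (modulus n) (q n) (gridRadius q c n) (Real.sqrt n)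
      (gridTau (q n) ((q n : ℝ) * gridRadius q c n * Real.sqrt n / √π) (gridD cD n) (gridG q cD n)) (m₃ n))
    (uniformSamples (Fin n) (ZMod (q n)) (m₃ n)) (gridBatches q cD c₃ n) (advThreshold (c₃ + 1) n)

/-- **The machine's rate-guess test**: the same estimate-and-flag test with the machine's rows `machGridRow` (finite-precision samplers)
and the machine's reference blocks `machRefBlock`. [cite: BrakerskiEtAl2013, Lemma 2.15 with §5] -/
def machTest (K : (Fin (m₃ n) → (Fin n → ZMod (q n)) × ZMod (q n)) → PMF Bool) :
    Distinguisher (Fin n) (ZMod (modulus n)) (gridG q cD n * (gridBatches q cD c₃ n * m₃ n)) :=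
  flatGuessTest K (gridBatches q cD c₃ n) (m₃ n) (fun i S => machGridRow q m₃ c cD n i S)
    (machRefBlock q m₃ n) (gridBatches q cD c₃ n) (advThreshold (c₃ + 1) n)

variable {q m₃ c cD c₃ n}

/-- The ideal row of `BLPRSMachineKernelParams.lean` is the row `rateGuessKernel` of `BLPRSRateGuess.lean`. [folklore] -/
theorem gridRow_eq_rateGuessKernel (i : Fin (gridG q cD n)) (S : Fin (m₃ n) → (Fin n → ZMod (modulus n)) × ZMod (modulus n)) :
    gridRow q m₃ c cD n i S =
      rateGuessKernel n (modulus n) (q n) (gridRadius q c n) (Real.sqrt n)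
        (gridTau (q n) ((q n : ℝ) * gridRadius q c n * Real.sqrt n / √π) (gridD cD n) (gridG q cD n)) (m₃ n) i S := rfl

end Tests

/-! ### The machine's test is close to the ideal one -/

section Close

variable {q : ℕ → ℕ} [∀ n, NeZero (q n)] {m₃ : ℕ → ℕ}

omit [∀ n, NeZero (q n)] in
/-- **`G·N` is polynomially bounded.** [folklore] -/
theorem isPolyBounded_gridGN (hq : IsPolyBounded q) (cD c₃ : ℕ) :
    IsPolyBounded (fun n => gridG q cD n * gridBatches q cD c₃ n) := by
  obtain ⟨pq, hpq⟩ := hq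
  refine ⟨(pq * (8 * Polynomial.X ^ cD) + 1) * (1024 * ((pq * (8 * Polynomial.X ^ cD) + 1) + 2) * Polynomial.X ^ (2 * c₃ + 2)), fun n => ?_⟩
  have hG : gridG q cD n ≤ (pq * (8 * Polynomial.X ^ cD) + 1).eval n := by
    unfold gridG gridD
    simp only [Polynomial.eval_add, Polynomial.eval_mul, Polynomial.eval_pow, Polynomial.eval_X, Polynomial.eval_one,
      Polynomial.eval_ofNat]
    exact Nat.add_le_add_right (Nat.mul_le_mul_right _ (hpq n)) 1
  unfold gridBatches
  simp only [Polynomial.eval_add, Polynomial.eval_mul, Polynomial.eval_pow, Polynomial.eval_X, Polynomial.eval_one,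
    Polynomial.eval_ofNat] at hG ⊢
  gcongr

/-- **The machine's test is `1/n^k`-close to the ideal test on every input law**, eventually: `G·N` kernel calls each `1/n^{k₁}`-close
(`eventually_tvDist_machGridRow_le_pow`), `N'` reference blocks each `m₃(n+1)2^{-n}`-close.
[cite: BrakerskiEtAl2013, Lemma 2.15 with §5; Goldreich2001, §3.2.2–§3.2.3] -/
theorem eventually_machTest_close (hq : IsPolyBounded q) (hm : IsPolyBounded m₃) (c cD c₃ k : ℕ) :
    ∀ᶠ n : ℕ in atTop, ∀ (K : (Fin (m₃ n) → (Fin n → ZMod (q n)) × ZMod (q n)) → PMF Bool)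
      (P : PMF (Fin (gridG q cD n * (gridBatches q cD c₃ n * m₃ n)) → (Fin n → ZMod (modulus n)) × ZMod (modulus n))),
      |(acceptProb (machTest q m₃ c cD c₃ n K) P).toReal - (acceptProb (idealTest q m₃ c cD c₃ n K) P).toReal| ≤ 1 / (n : ℝ) ^ k := by
  -- `G N / n^{k₁} ≤ 1/(2n^k)` and `N m₃ (n+1) n^k · 2 ≤ 2^{⌊d/2⌋} ≤ 2ⁿ`
  obtain ⟨k₁, hk₁⟩ := eventually_polyBounded_le_pow (isPolyBounded_gridGN hq cD c₃) 2 k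
  obtain ⟨pGN, hpGN⟩ := isPolyBounded_gridGN (q := q) hq cD c₃
  obtain ⟨pm, hpm⟩ := hm
  have hexp := eventually_mul_eval_le_two_pow_half_dim (pGN * pm * (Polynomial.X + 1) * Polynomial.X ^ k) 2
  filter_upwards [hk₁, eventually_tvDist_machGridRow_le_pow (m₃ := m₃) hq ⟨pm, hpm⟩ c cD k₁, hexp, eventually_ge_atTop 1]
    with n hk₁n hrow hexpn h1 K P
  have hn : (0 : ℝ) < n := by exact_mod_cast h1
  have hpk : (0 : ℝ) < (n : ℝ) ^ k := by positivity
  have hpk₁ : (0 : ℝ) < (n : ℝ) ^ k₁ := by positivity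
  have hd2 : (2 : ℝ) ^ (dim n / 2) ≤ (2 : ℝ) ^ n :=
    pow_le_pow_right₀ (by norm_num) (by have := Nat.sqrt_le_self n; unfold dim; omega)
  -- the generic perturbation bound, machine first
  have h := abs_acceptProb_flatGuessTest_sub_le K (gridBatches q cD c₃ n) (m₃ n)
    (fun i S => machGridRow q m₃ c cD n i S)
    (rateGuessKernel n (modulus n) (q n) (gridRadius q c n) (Real.sqrt n)
      (gridTau (q n) ((q n : ℝ) * gridRadius q c n * Real.sqrt n / √π) (gridD cD n) (gridG q cD n)) (m₃ n))
    (machRefBlock q m₃ n) (uniformSamples (Fin n) (ZMod (q n)) (m₃ n)) (gridBatches q cD c₃ n) (advThreshold (c₃ + 1) n)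
    (δκ := 1 / (n : ℝ) ^ k₁) (δU := (m₃ n : ℝ) * (((n : ℝ) + 1) * (1 / (2 : ℝ) ^ n)))
    (fun i S => by rw [← gridRow_eq_rateGuessKernel]; exact hrow i S) (tvDist_machRefBlock_le q m₃ n) P
  refine h.trans ?_
  -- `G (N / n^{k₁}) ≤ 1/(2 n^k)`
  have hA : (gridG q cD n : ℝ) * ((gridBatches q cD c₃ n : ℝ) * (1 / (n : ℝ) ^ k₁)) ≤ 1 / (2 * (n : ℝ) ^ k) := by
    have : 2 * (((gridG q cD n * gridBatches q cD c₃ n : ℕ) : ℝ)) * (n : ℝ) ^ k ≤ (n : ℝ) ^ k₁ := hk₁n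
    push_cast at this
    rw [mul_one_div, ← mul_div_assoc, div_le_div_iff₀ hpk₁ (by positivity), one_mul]
    nlinarith
  -- `N (m₃ (n+1)/2ⁿ) ≤ 1/(2 n^k)`
  have hB : (gridBatches q cD c₃ n : ℝ) * ((m₃ n : ℝ) * (((n : ℝ) + 1) * (1 / (2 : ℝ) ^ n))) ≤ 1 / (2 * (n : ℝ) ^ k) := by
    have hGN : (gridBatches q cD c₃ n : ℝ) ≤ ((pGN.eval n : ℕ) : ℝ) := by
      have h1' : gridBatches q cD c₃ n ≤ gridG q cD n * gridBatches q cD c₃ n := Nat.le_mul_of_pos_left _ (gridG_pos cD n)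
      exact_mod_cast h1'.trans (hpGN n)
    have hmle : (m₃ n : ℝ) ≤ ((pm.eval n : ℕ) : ℝ) := by exact_mod_cast hpm n
    have he := hexpn
    simp only [Polynomial.eval_mul, Polynomial.eval_add, Polynomial.eval_pow, Polynomial.eval_X, Polynomial.eval_one,
      Nat.cast_mul, Nat.cast_add, Nat.cast_pow, Nat.cast_one] at he
    rw [show (gridBatches q cD c₃ n : ℝ) * ((m₃ n : ℝ) * (((n : ℝ) + 1) * (1 / (2 : ℝ) ^ n))) =
      ((gridBatches q cD c₃ n : ℝ) * (m₃ n : ℝ) * ((n : ℝ) + 1)) / (2 : ℝ) ^ n by ring]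
    rw [div_le_div_iff₀ (by positivity) (by positivity), one_mul]
    calc (gridBatches q cD c₃ n : ℝ) * (m₃ n : ℝ) * ((n : ℝ) + 1) * (2 * (n : ℝ) ^ k)
        = 2 * ((gridBatches q cD c₃ n : ℝ) * (m₃ n : ℝ) * ((n : ℝ) + 1) * (n : ℝ) ^ k) := by ring
      _ ≤ 2 * (((pGN.eval n : ℕ) : ℝ) * ((pm.eval n : ℕ) : ℝ) * ((n : ℝ) + 1) * (n : ℝ) ^ k) := by gcongr
      _ ≤ (2 : ℝ) ^ (dim n / 2) := he
      _ ≤ (2 : ℝ) ^ n := hd2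
  calc (gridG q cD n : ℝ) * ((gridBatches q cD c₃ n : ℝ) * (1 / (n : ℝ) ^ k₁)) +
        (gridBatches q cD c₃ n : ℝ) * ((m₃ n : ℝ) * (((n : ℝ) + 1) * (1 / (2 : ℝ) ^ n)))
      ≤ 1 / (2 * (n : ℝ) ^ k) + 1 / (2 * (n : ℝ) ^ k) := add_le_add hA hB
    _ = 1 / (n : ℝ) ^ k := by field_simp; ring

end Close

end BLPRS2013

end Literature.Computability.Cryptography

end
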